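import Summits.AnomalousDissipation.AnomalousDissipation.Theorems.TaylorGreenLogLoudStates.Negative.HalfTurn
import Summits.AnomalousDissipation.AnomalousDissipation.Theorems.TaylorGreenLogLoudStates.Negative.CensusCostume
import Summits.AnomalousDissipation.AnomalousDissipation.Theorems.MirrorVarietyTaylorGreenLogLoudStatesStubDivIdentityBox
import Summits.AnomalousDissipation.AnomalousDissipation.Theorems.MirrorVarietyTaylorGreenLogLoudStatesStubSignedCountIdOutside
import Summits.AnomalousDissipation.AnomalousDissipation.Theorems.MirrorVarietyTaylorGreenLogLoudStatesStubCoerciveCutoff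

/-!
# Vocabulary and kernel-checked glue of the line `Sketch` (half-turn parity forcing)
# for the crux `MirrorVariety.TaylorGreenLogLoudStates` (stmt-AnomalousDissipation-15060)

Support file of the line lead (prover-line-stmt-AnomalousDissipation-15060-0), so that the line's registered
stubs, the census-coordinate files and the lead's skeleton
(`Cruxes/TaylorGreenLogLoudStates/Lines/Sketch.lean`, not importable) speak about the SAME declarations
(cf. `MirrorVarietyTaylorGreenLoudGalerkinStatesLine.lean` for the sibling crux).  Namespace
`….Theorems.TaylorGreenLogLoudStates.HalfTurn`.

* §1 **The ℤ₂-twisted Brouwer-degree lever, PROVED.**  `coercive_sum_sign_det_eq_one` — a `C¹` field on `ℝⁿ`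
  with `⟪F c, c⟫ > 0` for `‖c‖ ≥ R` whose zero set is a finite set of nondegenerate zeros has signed Jacobian count
  `∑ sign det DF = 1` (Kronecker's theorem on the algebraic count of singular points for a coercive field:
  Krasnosel'skiĭ–Zabreĭko 1984, Ch. 1, Thm 2.1 (Poincaré–Bohl) + §3 Property 3 + Thm 4.3 + Thm 6.3), assembled from
  the three landed analytic-degree stubs of the line: `DivIdentity.stub_divIdentityBox` (p98861),
  `SignedCount.stub_signedCountIdOutside` (p100975), `Cutoff.stub_coerciveCutoff` (p102618) — themselves built on the
  tree's Chang-2005 §3.1 core (`Literature.Analysis.Calculus.LocalDegreeFormula`, `JacobianNullLagrangian`,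
  `PeriodicDivergence/Mollifier`).  `stub_lever` — the registered lever of the skeleton: if the `H`-fixed zeros of a
  coercive `C¹` field form a finite nondegenerate set with signed count `≠ 1`, there is a zero OUTSIDE `Fix H`.
  `twistedDegreeLever_holds` DISCHARGES the refuter's named hypothesis `Negative.TwistedDegreeLever` (CensusCostume.lean).
* §2 the half-turn `H : x ↦ (½ − x₀, x₁, ½ − x₂)` of the Taylor–Green cell and `H`-symmetry `IsHSymm` are REUSED from the
  landed `Theorems/TaylorGreenLogLoudStates/Negative/HalfTurn.lean` (`Negative.halfTurnMat/halfTurnShift/halfTurn/IsHSymm`,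
  verbatim the line's vocabulary; `isHSymm_iff_periodic`, `isHSymm_tgForce` there).
* §3 milestone M1 `HBrokenSteadyStatesExist` (non-laminar `H`-broken `K`-symmetric steady Taylor–Green Galerkin states
  along `ν_j → 0⁺`), the parity census `GalerkinParityCensus ν`, and `hBroken_of_census : census ⇒ M1` (uses §1).
* §4 the heart `HBrokenLogLoudStates` and the glue `crux_of_hBrokenLogLoud : heart ⇒ crux` BY NAME.

Nothing positive about the crux is asserted unconditionally; §1 is unconditional.  References: Krasnosel'skiĭ–Zabreĭko,
*Geometrical Methods of Nonlinear Analysis* (1984) Ch. 1; K.-C. Chang, *Methods in Nonlinear Analysis* (2005) §3.1;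
P. Rabinowitz, J. Funct. Anal. 7 (1971); the line card `Cruxes/TaylorGreenLogLoudStates/Ideas/half-turn-parity-forcing.md`.
-/

-- `Summit.<Summit>.<Problem>` is the tree's mandated summit-side namespace (CONVENTIONS §2); duplicate deliberate.
set_option linter.dupNamespace false

noncomputable section

open scoped InnerProductSpace Topology BigOperators
open MeasureTheory Filter
open Literature.Analysis.FunctionSpaces Literature.Analysis.FunctionSpaces.Torus
open Summit.AnomalousDissipation.AnomalousDissipation.Theorems.TaylorGreenLoudGalerkinStates.Negative
open Summit.AnomalousDissipation.AnomalousDissipation.Theorems.TaylorGreenLoudGalerkinStates (reflMat actVec IsKSymm)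
open Summit.AnomalousDissipation.AnomalousDissipation.Theorems.TaylorGreenLogLoudStates.Negative
  (halfTurnMat halfTurnShift halfTurn IsHSymm TwistedDegreeLever ParityCensusData)

namespace Summit.AnomalousDissipation.AnomalousDissipation.Theorems.TaylorGreenLogLoudStates.HalfTurn

/-! ## §1 The ℤ₂-twisted Brouwer-degree lever (proved) -/

/-- A coercive field has no zero on or outside the coercivity sphere. [folklore] -/
theorem norm_lt_of_eq_zero {n : ℕ} {F : EuclideanSpace ℝ (Fin n) → EuclideanSpace ℝ (Fin n)} {R : ℝ}
    (hco : ∀ c, R ≤ ‖c‖ → 0 < ⟪F c, c⟫_ℝ) {c : EuclideanSpace ℝ (Fin n)} (hc : F c = 0) : ‖c‖ < R := by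
  by_contra h
  have h1 := hco c (not_lt.1 h)
  rw [hc, inner_zero_left] at h1
  exact lt_irrefl _ h1

/-- **Kronecker's theorem for coercive fields (signed count of nondegenerate zeros is `1`).**  Let
`F : ℝⁿ → ℝⁿ` be `C¹` with `⟪F c, c⟫ > 0` for `‖c‖ ≥ R > 0`, and let the finite set `S` be exactly the zero set of
`F`, all zeros nondegenerate.  Then `∑_{c ∈ S} sign det DF(c) = 1` (Krasnosel'skiĭ–Zabreĭko 1984, Ch. 1: Thm 2.1,
§3 Property 3, Thm 4.3, Thm 6.3).  Proof: cut `F` off to the identity outside `R + 1` without creating zeros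
(`Cutoff.stub_coerciveCutoff`) — the zero set and the Jacobians at the zeros are unchanged — and apply the
normalisation for fields equal to the identity outside a ball (`SignedCount.stub_signedCountIdOutside` with
`DivIdentity.stub_divIdentityBox`). [folklore] -/
theorem coercive_sum_sign_det_eq_one (n : ℕ) (F : EuclideanSpace ℝ (Fin n) → EuclideanSpace ℝ (Fin n))
    (S : Finset (EuclideanSpace ℝ (Fin n))) (hF : ContDiff ℝ 1 F)
    (hR : ∃ R : ℝ, 0 < R ∧ ∀ c, R ≤ ‖c‖ → 0 < ⟪F c, c⟫_ℝ) (hS : ∀ c, c ∈ S ↔ F c = 0)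
    (hnd : ∀ c ∈ S, (fderiv ℝ F c).det ≠ 0) :
    ∑ c ∈ S, Real.sign ((fderiv ℝ F c).det) = 1 := by
  obtain ⟨R, hR0, hco⟩ := hR
  obtain ⟨G, hG, hGF, hGid, hGco⟩ := Cutoff.stub_coerciveCutoff n F R hR0 hF hco
  have hSG : ∀ c, c ∈ S ↔ G c = 0 := fun c => by
    rw [hS]
    constructor
    · intro h
      rw [hGF c (norm_lt_of_eq_zero hco h).le]
      exact h
    · intro h
      rw [← hGF c (norm_lt_of_eq_zero hGco h).le]
      exact h
  have hfd : ∀ c ∈ S, fderiv ℝ G c = fderiv ℝ F c := fun c hc => by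
    refine Filter.EventuallyEq.fderiv_eq ?_
    have hlt : ‖c‖ < R := norm_lt_of_eq_zero hco ((hS c).1 hc)
    filter_upwards [Metric.isOpen_ball.mem_nhds (mem_ball_zero_iff.2 hlt)] with y hy
    exact hGF y (mem_ball_zero_iff.1 hy).le
  have key := SignedCount.stub_signedCountIdOutside DivIdentity.stub_divIdentityBox n G (R + 1) S (by linarith)
    hG hGid hSG (fun c hc => by rw [hfd c hc]; exact hnd c hc)
  rw [← key]
  exact Finset.sum_congr rfl fun c hc => by rw [hfd c hc]

/-- **`stub_lever` — twisted degree forces broken zeros** (the registered lever of the line, PROVED).  Let `F` be a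
`C¹` self-map of `ℝⁿ`, coercive (`⟪F c, c⟫ > 0` for `‖c‖ ≥ R > 0`), and `H` a linear involution.  If the zeros of
`F` inside `Fix H` form a finite set `S` of nondegenerate zeros whose signed Jacobian count differs from `1`, then
`F` has a zero OUTSIDE `Fix H` (else the zero set would be `S`, of signed count `1` by
`coercive_sum_sign_det_eq_one`).  For `H`-equivariant `F` the count flips exactly when a real `H`-odd eigenvalue
crosses `0` on a symmetric branch (a pitchfork) — the engine of the card `half-turn-parity-forcing`. [folklore] -/
theorem stub_lever : ∀ (n : ℕ) (F : EuclideanSpace ℝ (Fin n) → EuclideanSpace ℝ (Fin n))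
    (H : EuclideanSpace ℝ (Fin n) →L[ℝ] EuclideanSpace ℝ (Fin n)) (S : Finset (EuclideanSpace ℝ (Fin n))),
    (∀ c, H (H c) = c) → ContDiff ℝ 1 F →
    (∃ R : ℝ, 0 < R ∧ ∀ c, R ≤ ‖c‖ → 0 < ⟪F c, c⟫_ℝ) →
    (∀ c, c ∈ S ↔ (F c = 0 ∧ H c = c)) →
    (∀ c ∈ S, (fderiv ℝ F c).det ≠ 0) →
    (∑ c ∈ S, Real.sign ((fderiv ℝ F c).det)) ≠ 1 →
    ∃ c, F c = 0 ∧ H c ≠ c := by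
  intro n F H S _hH hF hco hS hnd hsum
  by_contra hcon
  push Not at hcon
  refine hsum (coercive_sum_sign_det_eq_one n F S hF hco (fun c => ?_) hnd)
  rw [hS c]
  exact ⟨fun hc => hc.1, fun hc => ⟨hc, hcon c hc⟩⟩

/-! ## §2 The half-turn of the Taylor–Green cell

Reused: `Negative.halfTurnMat`, `Negative.halfTurnShift`, `Negative.halfTurn`, `Negative.IsHSymm` (opened above). -/

/-- **The refuter's named hypothesis `TwistedDegreeLever` is discharged** (it is `stub_lever`). [folklore] -/
theorem twistedDegreeLever_holds : TwistedDegreeLever := stub_lever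

/-! ## §3 Milestone M1 and the parity census -/

/-- **M1 (non-laminar existence).**  Along some `ν_j → 0⁺`, for every `j` and all large `N`, there is an admissible
Galerkin steady Taylor–Green state (`Negative.IsSteadyState`, the crux's own bracket) which is `K`-symmetric but NOT
`H`-symmetric — hence off the laminar branch, which has every symmetry of `f_TG`. -/
def HBrokenSteadyStatesExist : Prop :=
  ∃ ν : ℕ → ℝ, (∀ j, 0 < ν j) ∧ Tendsto ν atTop (𝓝 0) ∧
    ∀ j, ∀ᶠ N in atTop, ∃ U : UnitAddTorus (Fin 3) → EuclideanSpace ℝ (Fin 3),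
      IsSteadyState (ν j) N tgForce U ∧ IsKSymm U ∧ ¬ IsHSymm U

/-- **The parity census along `ν`** (TG instantiation of the lever, abstract coordinates): for every `j` and all large
`N` there are Euclidean coordinates `ℝⁿ` of the `K`-symmetric admissible Galerkin states at resolution `N`, the steady
Galerkin map `F` in these coordinates with the half-turn `H` acting as a linear involution, `F` `C¹` and coercive, the
finite set `S` of `H`-symmetric zeros — nondegenerate, with signed Jacobian count `≠ 1` — and a realisation map `e`
sending zeros of `F` to `K`-symmetric admissible steady Taylor–Green states at `(ν j, N)` under which `H`-symmetry of
the field forces `H c = c` — written through the refuter's landed matrix `Negative.ParityCensusData` (CensusCostume.lean: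
with ABSTRACT coordinates the census is "M1 in costume", `parityCensus_iff_brokenStates`; the line therefore aims it at THE
Galerkin map: explicit coordinates `Census.censusMap` and the residual `Census.ParityCount`, files `…HalfTurnCensus*`). -/
def GalerkinParityCensus (ν : ℕ → ℝ) : Prop :=
  ∀ j, ∀ᶠ N in atTop, ParityCensusData (IsSteadyState (ν j) N tgForce) IsKSymm IsHSymm

/-- **Census ⇒ M1** (the lever `stub_lever` is proved, so the census alone forces non-laminar `H`-broken steady
Taylor–Green Galerkin states along `ν`). [folklore] -/
theorem hBroken_of_census {ν : ℕ → ℝ} (hν : ∀ j, 0 < ν j) (hlim : Tendsto ν atTop (𝓝 0))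
    (hcensus : GalerkinParityCensus ν) : HBrokenSteadyStatesExist := by
  refine ⟨ν, hν, hlim, fun j => ?_⟩
  filter_upwards [hcensus j] with N hN
  obtain ⟨n, F, H, S, e, hHH, hF, hco, hS, hnd, hpar, hreal⟩ := hN
  obtain ⟨c, hc0, hcH⟩ := stub_lever n F H S hHH hF hco hS hnd hpar
  obtain ⟨hst, hK, hHsym⟩ := hreal c hc0
  exact ⟨e c, hst, hK, fun h => hcH (hHsym h)⟩

/-! ## §4 The heart and the glue to the crux -/

/-- **Heart of the line.**  The log crux witnessed INSIDE the `H`-broken `K`-symmetric class (the through-flow column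
states of the card): admissible steady Taylor–Green Galerkin states along `ν_j → 0⁺`, `ν_j ≤ ¼`, with log energy
`∫|U|² ≤ E·log(1/ν_j)` and `ν`-independent loudness `ν_j‖∇U‖² ≥ c > 0`, `K`-symmetric and not `H`-symmetric. -/
def HBrokenLogLoudStates : Prop :=
  ∃ (ν : ℕ → ℝ) (E c : ℝ), (∀ j, 0 < ν j ∧ ν j ≤ 1 / 4) ∧ Tendsto ν atTop (𝓝 0) ∧ 0 < c ∧
    ∀ j, ∀ᶠ N in atTop, ∃ U : UnitAddTorus (Fin 3) → EuclideanSpace ℝ (Fin 3),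
      IsSteadyState (ν j) N tgForce U ∧ IsKSymm U ∧ ¬ IsHSymm U ∧
        ∫ x, ‖U x‖ ^ 2 ≤ E * Real.log (1 / ν j) ∧ c ≤ ν j * gradNormSq U

/-- **Heart ⇒ crux BY NAME** (drop the two symmetry conjuncts; `tgForce` is the crux's lambda, `rfl`). [folklore] -/
theorem crux_of_hBrokenLogLoud (h : HBrokenLogLoudStates) :
    Summit.AnomalousDissipation.AnomalousDissipation.Theses.MirrorVariety.TaylorGreenLogLoudStates := by
  obtain ⟨ν, E, c, hν, hlim, hc, hj⟩ := h
  intro f hf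
  subst hf
  refine ⟨ν, E, c, hν, hlim, hc, fun j => ?_⟩
  filter_upwards [hj j] with N hN
  obtain ⟨U, hU, -, -, hE, hl⟩ := hN
  exact ⟨U, hU, hE, hl⟩

/-- **M1 + heart-implication ⇒ crux** (the composition of the line at the level of this file's vocabulary: whoever
proves the census `∃ ν_j → 0⁺, GalerkinParityCensus ν` and the implication `HBrokenSteadyStatesExist →
HBrokenLogLoudStates` has proved the crux). [folklore] -/
theorem crux_of_census_of_heart
    (hcensus : ∃ ν : ℕ → ℝ, (∀ j, 0 < ν j) ∧ Tendsto ν atTop (𝓝 0) ∧ GalerkinParityCensus ν)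
    (hheart : HBrokenSteadyStatesExist → HBrokenLogLoudStates) :
    Summit.AnomalousDissipation.AnomalousDissipation.Theses.MirrorVariety.TaylorGreenLogLoudStates := by
  obtain ⟨ν, hν, hlim, hc⟩ := hcensus
  exact crux_of_hBrokenLogLoud (hheart (hBroken_of_census hν hlim hc))

end Summit.AnomalousDissipation.AnomalousDissipation.Theorems.TaylorGreenLogLoudStates.HalfTurn

end
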